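import Mathlib
import Literature.Computability.AlgebraicComplexity.BorderApolarityMembership
import Summits.ValiantsHypothesis.ValiantsHypothesis.Theorems.BorderApolarityFixedWitnessObstructionQPInterp
import Summits.ValiantsHypothesis.ValiantsHypothesis.Theorems.BorderApolarityToricWitnessObstructionQPStubLieIdentity
import Summits.ValiantsHypothesis.ValiantsHypothesis.Theorems.BorderApolarityToricWitnessObstructionQPStubLieStabilizerPer
import Summits.ValiantsHypothesis.ValiantsHypothesis.Theorems.BorderApolarityToricWitnessObstructionQPStubLieStabilizerPadded
import Summits.ValiantsHypothesis.ValiantsHypothesis.Theorems.BorderApolarityToricWitnessObstructionQPStubEigenCompletion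

/-!
# Border apolarity, crux `ToricWitnessObstructionQP` (stmt-ValiantsHypothesis-14753), line `Sketch`,
# reshape 4 — the STABILISER-TORUS NORMAL FORM WITH RELATIONS (registered stub `stub_normalFormRel`)

Route `ValiantsHypothesis/BorderApolarity`, crux item `stmt-ValiantsHypothesis-14753`, line `Sketch`,
reshape 4 (the stable normal form).  This file proves the registered stub `stub_normalFormRel`: the
stabiliser-torus normal form of an EXTREMAL toric representation
`pp = u · wHC_{w₁}^e (μ • g · det_m)` (`μ ≠ 0`) of the padded permanent `pp = X₀₀^{m-n} per_n`
(`3 ≤ n ≤ m`), re-proved from the landed `stub_normalForm` with the scalar `μ` carried in the input and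
with the renormalising data EXPORTED:

* the eigen-completion matrix `p ∈ GL` fixing the variables of `pp` (block variables and `X₀₀`),
* the torus-conjugation identity `p⁻¹ u diag(s^{w₁}) u⁻¹ p = diag(s^{w'})` for all `s`,
* the relation `g' · det_m = (p⁻¹ u) · (μ • g · det_m)`,

together with extremality of `g' · det_m` for `w'`, the representation `pp = wHC_{w'}^e (g' · det_m)`
and exchange-additivity of `w'` on the per-block.

Proof: verbatim the weight-transport argument of the landed `stub_normalForm`
(`…ToricWitnessObstructionQPStubNormalForm.lean`; Lie identity `stub_lieIdentity`, Lie stabiliser of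
the padded permanent `stub_lieStabilizer_padded ∘ stub_lieStabilizer_per`, eigen-completion
`stub_eigenCompletion`, intertwining of the tori at `s = 2`), applied to `μ • g · det_m`, which lies in
the orbit `GL · det_m` (the orbit is a cone, `BorderApolarity.smul_mem_glOrbit_detPoly`), so that
`g' := p⁻¹ u gμ` with `gμ · det_m = μ • g · det_m`.  The file is self-contained over the four landed
stubs S1–S4: the weight-transport lemmas of the `StubNormalForm` file are re-proved here as private
helpers (suffix `_rel`), so that this module does not depend on that module's build.
-/

open MvPolynomial Filter
open scoped BigOperators Matrix
open Literature.Computability.AlgebraicComplexity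

-- the mandated summit-side namespace repeats a component by design (single-problem summit)
set_option linter.dupNamespace false

namespace Summit.ValiantsHypothesis.ValiantsHypothesis.Theorems.BorderApolarityToricWitnessObstructionQP

noncomputable section

open Summit.ValiantsHypothesis.ValiantsHypothesis.Theorems.BorderApolarityFixedWitnessObstructionQP
  (coeff_linSubst_diagonal_pow)

/-! ## Weight transport lemmas (private copies of the `StubNormalForm` helpers) -/

/-- The torus substitution `x_k ↦ s^{w_k} x_k` multiplies a `w`-weighted homogeneous polynomial of
weight `j` by `s^j`. [folklore] -/
private theorem linSubst_diagonal_pow_of_isWeightedHomogeneous_rel {σ : Type*} [Fintype σ]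
    [DecidableEq σ] (w : σ → ℕ) (s : ℂ) {G : MvPolynomial σ ℂ} {j : ℕ}
    (hG : IsWeightedHomogeneous w G j) :
    linSubst σ ℂ (Matrix.diagonal fun k => s ^ (w k)) G = s ^ j • G := by
  ext d
  rw [coeff_linSubst_diagonal_pow, coeff_smul, smul_eq_mul]
  by_cases hd : coeff d G = 0
  · rw [hd, mul_zero, mul_zero]
  · rw [hG hd]

/-- Conversely, a polynomial on which `x_k ↦ 2^{w_k} x_k` acts by `2^j` is `w`-weighted homogeneous
of weight `j` (the characters `2^v`, `v ∈ ℕ`, are distinct). [folklore] -/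
private theorem isWeightedHomogeneous_of_linSubst_diagonal_two_rel {σ : Type*} [Fintype σ]
    [DecidableEq σ] (w : σ → ℕ) {H : MvPolynomial σ ℂ} {j : ℕ}
    (h : linSubst σ ℂ (Matrix.diagonal fun k => (2 : ℂ) ^ (w k)) H = (2 : ℂ) ^ j • H) :
    IsWeightedHomogeneous w H j := by
  intro d hd
  have hc := congrArg (coeff d) h
  rw [coeff_linSubst_diagonal_pow, coeff_smul, smul_eq_mul] at hc
  have h2 : ((2 : ℂ) ^ (Finsupp.weight w d) - 2 ^ j) * coeff d H = 0 := by
    rw [sub_mul, hc, sub_self]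
  rcases mul_eq_zero.1 h2 with h0 | h0
  · rw [sub_eq_zero] at h0
    have h' : ((2 : ℕ) : ℂ) ^ (Finsupp.weight w d) = ((2 : ℕ) : ℂ) ^ j := by exact_mod_cast h0
    have h'' : (2 : ℕ) ^ (Finsupp.weight w d) = 2 ^ j := by exact_mod_cast h'
    exact Nat.pow_right_injective le_rfl h''
  · exact absurd h0 hd

/-- A polynomial is the (finite) sum of its weighted homogeneous components over the set of weights
that occur in its support. [folklore] -/
private theorem eq_sum_weightedHomogeneousComponent_image_rel {σ : Type*} (w : σ → ℕ)
    (F : MvPolynomial σ ℂ) :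
    F = ∑ j ∈ F.support.image (Finsupp.weight w), weightedHomogeneousComponent w j F := by
  classical
  ext d
  rw [coeff_sum]
  simp only [coeff_weightedHomogeneousComponent]
  rw [Finset.sum_ite_eq]
  split_ifs with h
  · rfl
  · by_contra hne
    exact h (Finset.mem_image_of_mem _ (mem_support_iff.2 hne))

/-- **Weight transport.** If `A` intertwines the one-parameter tori at `s = 2`,
`A · D_w(2) = D_{w'}(2) · A`, then `A` maps `w`-weighted homogeneous polynomials of weight `j` to
`w'`-weighted homogeneous polynomials of weight `j`. [folklore] -/
private theorem isWeightedHomogeneous_linSubst_of_intertwine_rel {σ : Type*} [Fintype σ]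
    [DecidableEq σ] (w w' : σ → ℕ) (A : Matrix σ σ ℂ)
    (hA : A * Matrix.diagonal (fun k => (2 : ℂ) ^ (w k)) =
      Matrix.diagonal (fun k => (2 : ℂ) ^ (w' k)) * A)
    {G : MvPolynomial σ ℂ} {j : ℕ} (hG : IsWeightedHomogeneous w G j) :
    IsWeightedHomogeneous w' (linSubst σ ℂ A G) j := by
  apply isWeightedHomogeneous_of_linSubst_diagonal_two_rel w'
  have h := congrArg (fun M => linSubst σ ℂ M G) hA
  simp only [linSubst_mul, AlgHom.comp_apply] at h
  rw [← h, linSubst_diagonal_pow_of_isWeightedHomogeneous_rel w 2 hG, map_smul]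

/-- A linear substitution whose columns at the variables of the padded permanent (the block
variables and `X₀₀`) are the corresponding coordinate vectors fixes the padded permanent
`X₀₀^{m-n} per_n`. [folklore] -/
private theorem linSubst_paddedPerPoly_eq_self_rel (n m : ℕ) [NeZero m]
    (P : Matrix (Fin m × Fin m) (Fin m × Fin m) ℂ)
    (hP : ∀ a : Fin m × Fin m, ((m - n ≤ (a.1 : ℕ) ∧ m - n ≤ (a.2 : ℕ)) ∨ a = (0, 0)) →
      ∀ b : Fin m × Fin m, P b a = if b = a then 1 else 0) :
    linSubst (Fin m × Fin m) ℂ P (paddedPerPoly ℂ n m) = paddedPerPoly ℂ n m := by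
  have hXa : ∀ a : Fin m × Fin m, ((m - n ≤ (a.1 : ℕ) ∧ m - n ≤ (a.2 : ℕ)) ∨ a = (0, 0)) →
      linSubst (Fin m × Fin m) ℂ P (X a) = X a := by
    intro a ha
    rw [linSubst_X]
    simp only [hP a ha, ite_smul, one_smul, zero_smul, Finset.sum_ite_eq', Finset.mem_univ,
      if_true]
  have hren : (linSubst (Fin m × Fin m) ℂ P).comp
      (rename fun ij : BlockIdx n m × BlockIdx n m => ((ij.1 : Fin m), (ij.2 : Fin m))) =
      rename fun ij : BlockIdx n m × BlockIdx n m => ((ij.1 : Fin m), (ij.2 : Fin m)) := by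
    apply MvPolynomial.algHom_ext
    intro ij
    rw [AlgHom.comp_apply, rename_X]
    exact hXa _ (Or.inl ⟨ij.1.2, ij.2.2⟩)
  unfold paddedPerPoly
  rw [map_mul, map_pow, hXa (0, 0) (Or.inr rfl)]
  congr 1
  have h := AlgHom.congr_fun hren (perPoly (BlockIdx n m) ℂ)
  rwa [AlgHom.comp_apply] at h

/-! ## The normal form with relations -/

/-- **Stabiliser-torus normal form with relations** (card `stabiliser-torus-normal-form`, reshape 4).
For `3 ≤ n ≤ m`, an extremal toric representation `pp = u · wHC_{w₁}^e (μ • g · det_m)` (`μ ≠ 0`) of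
the padded permanent can be renormalised to `u = 1`: there are `p, g' ∈ GL` and a weight `w'` with
`p` fixing the variables of `pp`, `p⁻¹ u diag(s^{w₁}) u⁻¹ p = diag(s^{w'})`,
`g' · det_m = (p⁻¹ u) · (μ • g · det_m)` extremal for `w'`, `pp = wHC_{w'}^e (g' · det_m)`, and `w'`
exchange-additive on the per-block. [folklore] -/
theorem stub_normalFormRel : ∀ (n m : ℕ) [NeZero m], 3 ≤ n → n ≤ m →
    ∀ (u g : GL (Fin m × Fin m) ℂ) (w₁ : Fin m × Fin m → ℕ) (e : ℕ) (μ : ℂ), μ ≠ 0 →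
    (∀ d ∈ (linSubst (Fin m × Fin m) ℂ (g : Matrix (Fin m × Fin m) (Fin m × Fin m) ℂ)
      (detPoly (Fin m) ℂ)).support, Finsupp.weight w₁ d ≤ e) →
    paddedPerPoly ℂ n m = linSubst (Fin m × Fin m) ℂ (u : Matrix (Fin m × Fin m) (Fin m × Fin m) ℂ)
      (weightedHomogeneousComponent w₁ e
        (μ • linSubst (Fin m × Fin m) ℂ (g : Matrix (Fin m × Fin m) (Fin m × Fin m) ℂ) (detPoly (Fin m) ℂ))) →
    ∃ (p g' : GL (Fin m × Fin m) ℂ) (w' : Fin m × Fin m → ℕ),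
      (∀ a : Fin m × Fin m, ((m - n ≤ (a.1 : ℕ) ∧ m - n ≤ (a.2 : ℕ)) ∨ a = (0, 0)) →
        ∀ b : Fin m × Fin m, (p : Matrix (Fin m × Fin m) (Fin m × Fin m) ℂ) b a = if b = a then 1 else 0) ∧
      (∀ s : ℂ, ((p⁻¹ : GL (Fin m × Fin m) ℂ) : Matrix (Fin m × Fin m) (Fin m × Fin m) ℂ) *
        (u : Matrix (Fin m × Fin m) (Fin m × Fin m) ℂ) * Matrix.diagonal (fun k => s ^ (w₁ k)) *
        ((u⁻¹ : GL (Fin m × Fin m) ℂ) : Matrix (Fin m × Fin m) (Fin m × Fin m) ℂ) *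
        (p : Matrix (Fin m × Fin m) (Fin m × Fin m) ℂ) = Matrix.diagonal (fun k => s ^ (w' k))) ∧
      linSubst (Fin m × Fin m) ℂ (g' : Matrix (Fin m × Fin m) (Fin m × Fin m) ℂ) (detPoly (Fin m) ℂ) =
        linSubst (Fin m × Fin m) ℂ ((p⁻¹ * u : GL (Fin m × Fin m) ℂ) : Matrix (Fin m × Fin m) (Fin m × Fin m) ℂ)
          (μ • linSubst (Fin m × Fin m) ℂ (g : Matrix (Fin m × Fin m) (Fin m × Fin m) ℂ) (detPoly (Fin m) ℂ)) ∧
      (∀ d ∈ (linSubst (Fin m × Fin m) ℂ (g' : Matrix (Fin m × Fin m) (Fin m × Fin m) ℂ)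
        (detPoly (Fin m) ℂ)).support, Finsupp.weight w' d ≤ e) ∧
      paddedPerPoly ℂ n m = weightedHomogeneousComponent w' e
        (linSubst (Fin m × Fin m) ℂ (g' : Matrix (Fin m × Fin m) (Fin m × Fin m) ℂ) (detPoly (Fin m) ℂ)) ∧
      (∀ i j k l : Fin m, m - n ≤ (i : ℕ) → m - n ≤ (k : ℕ) → m - n ≤ (j : ℕ) → m - n ≤ (l : ℕ) →
        w' (i, j) + w' (k, l) = w' (i, l) + w' (k, j)) := by
  intro n m _ h3 hnm u g w₁ e μ hμ hext hpp
  classical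
  -- notation
  set F : MvPolynomial (Fin m × Fin m) ℂ :=
    linSubst (Fin m × Fin m) ℂ (g : Matrix (Fin m × Fin m) (Fin m × Fin m) ℂ) (detPoly (Fin m) ℂ) with hF
  set G : MvPolynomial (Fin m × Fin m) ℂ := weightedHomogeneousComponent w₁ e (μ • F) with hG
  set pp : MvPolynomial (Fin m × Fin m) ℂ := paddedPerPoly ℂ n m with hppdef
  set N : Matrix (Fin m × Fin m) (Fin m × Fin m) ℂ :=
    (u : Matrix (Fin m × Fin m) (Fin m × Fin m) ℂ) * Matrix.diagonal (fun k => (w₁ k : ℂ)) *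
      ((u⁻¹ : GL (Fin m × Fin m) ℂ) : Matrix (Fin m × Fin m) (Fin m × Fin m) ℂ) with hN
  have hGhom : IsWeightedHomogeneous w₁ G e :=
    weightedHomogeneousComponent_isWeightedHomogeneous e (μ • F)
  -- S1: the Lie identity
  have hLie := stub_lieIdentity (Fin m × Fin m) u w₁ e G pp hGhom hpp
  -- S2 + S3: the Lie stabiliser of the padded permanent
  obtain ⟨hcol, hadd⟩ := stub_lieStabilizer_padded stub_lieStabilizer_per n m h3 hnm N (e : ℂ) hLie
  -- S4: eigen-completion
  set U : Finset (Fin m × Fin m) :=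
    Finset.univ.filter fun a : Fin m × Fin m => (m - n ≤ (a.1 : ℕ) ∧ m - n ≤ (a.2 : ℕ)) ∨ a = (0, 0)
    with hU
  have hUmem : ∀ a : Fin m × Fin m, a ∈ U ↔ ((m - n ≤ (a.1 : ℕ) ∧ m - n ≤ (a.2 : ℕ)) ∨ a = (0, 0)) := by
    intro a; simp [hU]
  obtain ⟨p, w', hpU, hw'U, hconj⟩ := stub_eigenCompletion (Fin m × Fin m) u w₁ U
    (fun i hi j hj => hcol i ((hUmem i).1 hi) j hj)
  have hw'N : ∀ i ∈ U, (w' i : ℂ) = N i i := fun i hi => (hw'U i hi).trans rfl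
  -- the scalar is absorbed into the orbit: `μ • F = gμ · det_m`
  have hForb : F ∈ glOrbit (Fin m × Fin m) ℂ (detPoly (Fin m) ℂ) := ⟨g, linSubstRep_apply _ _ g _⟩
  obtain ⟨gμ, hgμ⟩ := BorderApolarity.smul_mem_glOrbit_detPoly hForb hμ
  have hgμ' : linSubst (Fin m × Fin m) ℂ gμ.val (detPoly (Fin m) ℂ) = μ • F :=
    (linSubstRep_apply _ _ gμ _).symm.trans hgμ
  -- the renormalised data
  set u' : GL (Fin m × Fin m) ℂ := p⁻¹ * u with hu'
  -- (a) `p` and `p⁻¹` fix `pp`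
  have hpfix : ∀ a : Fin m × Fin m, ((m - n ≤ (a.1 : ℕ) ∧ m - n ≤ (a.2 : ℕ)) ∨ a = (0, 0)) →
      ∀ b : Fin m × Fin m, (p : Matrix (Fin m × Fin m) (Fin m × Fin m) ℂ) b a = if b = a then 1 else 0 :=
    fun a ha b => hpU a ((hUmem a).2 ha) b
  have hfix : linSubst (Fin m × Fin m) ℂ p.val pp = pp := linSubst_paddedPerPoly_eq_self_rel n m _ hpfix
  have hfix' : linSubst (Fin m × Fin m) ℂ (p⁻¹).val pp = pp := by
    calc linSubst (Fin m × Fin m) ℂ (p⁻¹).val pp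
        = linSubst (Fin m × Fin m) ℂ (p⁻¹).val (linSubst (Fin m × Fin m) ℂ p.val pp) := by
          rw [hfix]
      _ = pp := by
          rw [← AlgHom.comp_apply, ← linSubst_mul, Units.inv_mul, linSubst_one, AlgHom.id_apply]
  -- (b) torus intertwining at `s = 2`: `u' · D_{w₁}(2) = D_{w'}(2) · u'`
  have hu'val : u'.val = (p⁻¹).val * u.val := Units.val_mul p⁻¹ u
  have hkey : u'.val * Matrix.diagonal (fun k => (2 : ℂ) ^ (w₁ k)) =
      Matrix.diagonal (fun k => (2 : ℂ) ^ (w' k)) * u'.val := by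
    have h1 : p.val * (p⁻¹).val = 1 := p.mul_inv
    have h2 : (u⁻¹).val * u.val = 1 := u.inv_mul
    rw [hu'val]
    calc (p⁻¹).val * u.val * Matrix.diagonal (fun k => (2 : ℂ) ^ (w₁ k))
        = (p⁻¹).val * u.val * Matrix.diagonal (fun k => (2 : ℂ) ^ (w₁ k)) *
            ((u⁻¹).val * (p.val * (p⁻¹).val) * u.val) := by
          rw [h1, Matrix.mul_one, h2, Matrix.mul_one]
      _ = (p⁻¹).val * u.val * Matrix.diagonal (fun k => (2 : ℂ) ^ (w₁ k)) * (u⁻¹).val *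
            p.val * ((p⁻¹).val * u.val) := by
          simp only [Matrix.mul_assoc]
      _ = Matrix.diagonal (fun k => (2 : ℂ) ^ (w' k)) * ((p⁻¹).val * u.val) := by
          rw [hconj 2]
  -- (c) weight transport: `u'` maps `w₁`-weight-`j` forms to `w'`-weight-`j` forms
  have hH : ∀ j : ℕ, IsWeightedHomogeneous w'
      (linSubst (Fin m × Fin m) ℂ u'.val (weightedHomogeneousComponent w₁ j (μ • F))) j := fun j =>
    isWeightedHomogeneous_linSubst_of_intertwine_rel w₁ w' u'.val hkey
      (weightedHomogeneousComponent_isWeightedHomogeneous j (μ • F))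
  -- (d) decomposition of `F' = u' · (μ • F)` along the `w₁`-weights occurring in `F`
  have hsupp : (μ • F).support = F.support := MvPolynomial.support_smul_eq hμ F
  have hF'eq : linSubst (Fin m × Fin m) ℂ (u' * gμ).val (detPoly (Fin m) ℂ) =
      linSubst (Fin m × Fin m) ℂ u'.val (μ • F) := by
    rw [Units.val_mul, linSubst_mul, AlgHom.comp_apply, hgμ']
  have hF'sum : linSubst (Fin m × Fin m) ℂ u'.val (μ • F) =
      ∑ j ∈ F.support.image (Finsupp.weight w₁),
        linSubst (Fin m × Fin m) ℂ u'.val (weightedHomogeneousComponent w₁ j (μ • F)) := by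
    have h := (congrArg (linSubst (Fin m × Fin m) ℂ u'.val)
      (eq_sum_weightedHomogeneousComponent_image_rel w₁ (μ • F))).trans (map_sum _ _ _)
    rwa [hsupp] at h
  have heS : e ∈ F.support.image (Finsupp.weight w₁) := by
    by_contra heS
    apply BorderApolarity.paddedPerPoly_ne_zero n m
    show pp = 0
    have hG0 : G = 0 := by
      rw [hG]
      apply weightedHomogeneousComponent_eq_zero'
      intro d hd hwd
      rw [hsupp] at hd
      exact heS (Finset.mem_image.2 ⟨d, hd, hwd⟩)
    rw [hpp, hG0, map_zero]
  have hcompF' : weightedHomogeneousComponent w' e (linSubst (Fin m × Fin m) ℂ u'.val (μ • F)) =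
      linSubst (Fin m × Fin m) ℂ u'.val G := by
    rw [hF'sum, map_sum, Finset.sum_eq_single_of_mem e heS]
    · exact (hH e).weightedHomogeneousComponent_same
    · intro j _ hje
      exact (hH j).weightedHomogeneousComponent_ne e (Ne.symm hje)
  refine ⟨p, u' * gμ, w', hpfix, hconj, hF'eq, ?_, ?_, ?_⟩
  · -- (i) extremality: a monomial of `F' = Σ_j u' · G_j` lies in some `u' · G_j`,
    -- and `j` is a `w₁`-weight of `F`, hence `≤ e`
    intro d hd
    rw [hF'eq, hF'sum, mem_support_iff, coeff_sum] at hd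
    obtain ⟨j, hjS, hj⟩ := Finset.exists_ne_zero_of_sum_ne_zero hd
    rw [hH j hj]
    obtain ⟨d₀, hd₀, rfl⟩ := Finset.mem_image.1 hjS
    exact hext d₀ hd₀
  · -- (ii) `wHC_{w'}^e F' = u' · G = p⁻¹ · (u · G) = p⁻¹ · pp = pp`
    rw [hF'eq, hcompF', hu'val, linSubst_mul, AlgHom.comp_apply, ← hpp, hfix']
  · -- additivity on the block, read off `N` through `w'_i = N_ii`
    intro i j k l hi hk hj hl
    have hij : (i, j) ∈ U := (hUmem _).2 (Or.inl ⟨hi, hj⟩)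
    have hkl : (k, l) ∈ U := (hUmem _).2 (Or.inl ⟨hk, hl⟩)
    have hil : (i, l) ∈ U := (hUmem _).2 (Or.inl ⟨hi, hl⟩)
    have hkj : (k, j) ∈ U := (hUmem _).2 (Or.inl ⟨hk, hj⟩)
    have h := hadd i j k l hi hk hj hl
    rw [← hw'N _ hij, ← hw'N _ hkl, ← hw'N _ hil, ← hw'N _ hkj] at h
    exact_mod_cast h

end

end Summit.ValiantsHypothesis.ValiantsHypothesis.Theorems.BorderApolarityToricWitnessObstructionQP
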